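import Mathlib
import Summits.KontsevichZagierPeriods.KontsevichZagierPeriods.Theorems.InverseLandauTateFamilyKernelStubLinResidues

/-!
# Crux `TateFamilyKernel` (stmt-KontsevichZagierPeriods-9130), line `Sketch` — `stub_sfLogCoeff`

Symmetric-fold class `Q = 1 − ϖ z₁(1−z₁)(α + βz₂)` (`0 < α`, `0 < β`), step 3a: the ANALYTIC half
of the log-elimination (`stub_sfLogElim` is the algebraic half). Notation: `u = x(1−x)`,
`w = α + βs`, `f_y(x) = P(x, (y/u − α)/β)/u` (the residue form along the polar curve `u·w = y`),
`L(x) = log|x| − log|1−x|`.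

* `SfLogCoeff.ftc` — **the density hypothesis, integrated**: in the FOLD coordinate
  `x = φ(s) = (1 − √(1−4y/w))/2` (`u(φ) = y/w`, `φ((4y−α)/β) = ½`) the density integrand
  `P(φ(s),s)/(w√(1−4y/w))` is `−β⁻¹ d/ds F(φ(s))` for ANY primitive `F` of `f_y` off `{0,1}`; it is
  integrable (`(continuous) × d/ds √(1−4y/w)`, the latter `≥ 0`), so the fundamental theorem of
  calculus on `[(4y−α)/β, 1]` gives `F(x₁(y)) = F(½)`, `x₁(y) = (1 − √(1 − 4y/(α+β)))/2`.
* `SfLogCoeff.logElim` — **log elimination on the conic**: if `F_y = R(y,x)/u^K + Λ(y) L(x)`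
  (`R ∈ ℚ[y,x]`, `Λ ∈ ℚ[y]`) satisfies `F_y(x₁(y)) = F_y(½)` on `(α/4, (α+β)/4)`, then `Λ = 0`:
  with `x₁ = σ/(1+σ)`, `y = (α+β)σ/(1+σ)²`, `σ ∈ (α/(α+β), 1)`, one has `L(x₁) = log σ` and the
  identity reads `g(σ) log σ = f(σ)` for real polynomials `f, g` (`SfLogCoeff.ratClosure` clears the
  denominators `σ^i(1+σ)^j`), so `g = 0` by `LinResidues.eq_zero_of_mul_log_eq` (p142381), i.e.
  `Λ` vanishes on an infinite set.
* `stub_sfLogCoeff`: hence the `log`-coefficient `Λ` of any such primitive of `f_y` vanishes.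

Mathlib + the landed `StubLinResidues` helpers only; no named fact, no new definition.
-/

noncomputable section

open MeasureTheory Set MvPolynomial
open scoped Topology

namespace Summit.KontsevichZagierPeriods.InverseLandau.TateFamilyKernel.Descent

namespace SfLogCoeff

/-- **The density hypothesis, integrated.** For `y ∈ (α/4, (α+β)/4)`, `ζ = (4y−α)/β`, `w ≥ 4y > 0`
on `[ζ,1]`; the fold branch `φ(s) = (1 − √(1 − 4y/w))/2` has `φ(1−φ) = y/w`, `φ(ζ) = ½`, and for any
primitive `F` of `f_y` off `{0,1}`, `d/ds F(φ(s)) = −β · P(φ(s),s)/(w√(1−4y/w))` on `(ζ,1)`, an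
integrable function (`(continuous) × d/ds √(1−4y/w)`); so `∫_ζ^1 (density) = 0` gives
`F(φ(1)) = F(½)`. [folklore] -/
theorem ftc (α β : ℚ) (P : MvPolynomial (Fin 2) ℚ) (hα : 0 < α) (hβ : 0 < β)
    (y : ℝ) (hy : y ∈ Ioo ((α : ℝ) / 4) (((α : ℝ) + β) / 4))
    (hΦ : ∫ s in Ioo ((4 * y - α) / β) 1,
      aeval ![(1 - Real.sqrt (1 - 4 * y / ((α : ℝ) + β * s))) / 2, s] P /
        (((α : ℝ) + β * s) * Real.sqrt (1 - 4 * y / ((α : ℝ) + β * s))) = 0)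
    (F : ℝ → ℝ) (hF : ∀ x : ℝ, x ≠ 0 → x ≠ 1 →
      HasDerivAt F (aeval ![x, (y / (x * (1 - x)) - α) / β] P / (x * (1 - x))) x) :
    F ((1 - Real.sqrt (1 - 4 * y / ((α : ℝ) + β))) / 2) = F 2⁻¹ := by
  set ζ : ℝ := (4 * y - α) / β with hζ
  have hβ0 : (0 : ℝ) < β := by exact_mod_cast hβ
  have hα0 : (0 : ℝ) < α := by exact_mod_cast hα
  have hy0 : 0 < y := by linarith [hy.1]
  have hζ1 : ζ < 1 := by rw [hζ, div_lt_one hβ0]; linarith [hy.2]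
  have hwζ : (α : ℝ) + β * ζ = 4 * y := by rw [hζ]; field_simp; ring
  have hw : ∀ s ∈ Icc ζ 1, 4 * y ≤ (α : ℝ) + β * s := fun s hs => by
    have := mul_le_mul_of_nonneg_left hs.1 hβ0.le
    linarith
  have hw' : ∀ s, ζ < s → 4 * y < (α : ℝ) + β * s := fun s hs => by
    have := mul_lt_mul_of_pos_left hs hβ0
    linarith
  have hv : ∀ s ∈ Icc ζ 1, 0 ≤ 1 - 4 * y / ((α : ℝ) + β * s) := fun s hs => by
    rw [sub_nonneg, div_le_one (by linarith [hw s hs])]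
    exact hw s hs
  have hv' : ∀ s, ζ < s → 0 < 1 - 4 * y / ((α : ℝ) + β * s) := fun s hs => by
    rw [sub_pos, div_lt_one (by linarith [hw' s hs])]
    exact hw' s hs
  -- the fold branch `φ` : `u(φ(s)) = y / w(s)` on `[ζ, 1]`
  set φ : ℝ → ℝ := fun s => (1 - Real.sqrt (1 - 4 * y / ((α : ℝ) + β * s))) / 2 with hφ
  have hφu : ∀ s ∈ Icc ζ 1, φ s * (1 - φ s) = y / ((α : ℝ) + β * s) := fun s hs => by
    have h1 := Real.sq_sqrt (hv s hs)
    have h2 : φ s * (1 - φ s) = (1 - Real.sqrt (1 - 4 * y / ((α : ℝ) + β * s)) ^ 2) / 4 := by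
      simp only [hφ]
      ring
    rw [h2, h1]
    field_simp
    ring
  have hφ0 : ∀ s ∈ Icc ζ 1, φ s ≠ 0 ∧ φ s ≠ 1 := fun s hs => by
    have h1 : φ s * (1 - φ s) ≠ 0 := by
      rw [hφu s hs]
      exact div_ne_zero hy0.ne' (by linarith [hw s hs])
    exact ⟨fun h => h1 (by rw [h, zero_mul]), fun h => h1 (by rw [h, sub_self, mul_zero])⟩
  have hsqc : ContinuousOn (fun s => Real.sqrt (1 - 4 * y / ((α : ℝ) + β * s))) (Icc ζ 1) :=
    (continuousOn_const.sub (continuousOn_const.div (by fun_prop)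
      fun s hs => by linarith [hw s hs])).sqrt
  have hφc : ContinuousOn φ (Icc ζ 1) := (continuousOn_const.sub hsqc).div_const _
  have hlin : ∀ s, HasDerivAt (fun s' : ℝ => (α : ℝ) + β * s') (β : ℝ) s := fun s => by
    simpa using ((hasDerivAt_id s).const_mul (β : ℝ)).const_add (α : ℝ)
  have hvd : ∀ s, ζ < s → HasDerivAt (fun s' : ℝ => 1 - 4 * y / ((α : ℝ) + β * s'))
      (4 * y * β / ((α : ℝ) + β * s) ^ 2) s := fun s hs => by
    have hw0 : (α : ℝ) + β * s ≠ 0 := by linarith [hw' s hs]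
    refine (((hasDerivAt_const s (4 * y)).div (hlin s) hw0).const_sub 1).congr_deriv ?_
    field_simp
    ring
  -- `d/ds F(φ(s)) = −β · (density integrand)` on `(ζ, 1)`
  have hGd : ∀ s ∈ Ioo ζ 1, HasDerivAt (F ∘ φ) (-(β : ℝ) * (aeval ![φ s, s] P /
      (((α : ℝ) + β * s) * Real.sqrt (1 - 4 * y / ((α : ℝ) + β * s))))) s := by
    intro s hs
    have hsI : s ∈ Icc ζ 1 := Ioo_subset_Icc_self hs
    have hw0 : (0 : ℝ) < (α : ℝ) + β * s := by linarith [hw' s hs.1]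
    have hsq : Real.sqrt (1 - 4 * y / ((α : ℝ) + β * s)) ≠ 0 := (Real.sqrt_pos.2 (hv' s hs.1)).ne'
    have hφd : HasDerivAt φ (-(4 * y * β / ((α : ℝ) + β * s) ^ 2 /
        (2 * Real.sqrt (1 - 4 * y / ((α : ℝ) + β * s)))) / 2) s :=
      (((hvd s hs.1).sqrt (hv' s hs.1).ne').const_sub 1).div_const 2
    have hFd := hF (φ s) (hφ0 s hsI).1 (hφ0 s hsI).2
    rw [hφu s hsI] at hFd
    have h2 : (y / (y / ((α : ℝ) + β * s)) - α) / β = s := by field_simp; ring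
    rw [h2] at hFd
    refine (hFd.comp s hφd).congr_deriv ?_
    field_simp
    ring
  have hGc : ContinuousOn (F ∘ φ) (Icc ζ 1) := fun s hs =>
    (hF (φ s) (hφ0 s hs).1 (hφ0 s hs).2).continuousAt.comp_continuousWithinAt (hφc s hs)
  -- integrability of the density integrand: (continuous on `[ζ,1]`) × `d/ds √(1 − 4y/w)` (`≥ 0`)
  have hint : IntervalIntegrable (fun s => -(β : ℝ) * (aeval ![φ s, s] P /
      (((α : ℝ) + β * s) * Real.sqrt (1 - 4 * y / ((α : ℝ) + β * s))))) volume ζ 1 := by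
    refine (intervalIntegrable_iff.2 ?_).const_mul _
    rw [uIoc_of_le hζ1.le]
    have hh : IntegrableOn (fun s => 4 * y * β / ((α : ℝ) + β * s) ^ 2 /
        (2 * Real.sqrt (1 - 4 * y / ((α : ℝ) + β * s)))) (Ioc ζ 1) :=
      intervalIntegral.integrableOn_deriv_of_nonneg hsqc
        (fun s hs => (hvd s hs.1).sqrt (hv' s hs.1).ne') (fun s hs => by positivity)
    have hPc : Continuous fun z : Fin 2 → ℝ => aeval z P := by
      have h1 : (fun z : Fin 2 → ℝ => aeval z P) = fun z => eval z (map (algebraMap ℚ ℝ) P) := by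
        funext z
        rw [eval_map, aeval_def]
      rw [h1]
      exact MvPolynomial.continuous_eval _
    have hvec : ContinuousOn (fun s => (![φ s, s] : Fin 2 → ℝ)) (Icc ζ 1) :=
      continuousOn_pi.2 (Fin.forall_fin_two.2 ⟨hφc, continuousOn_id⟩)
    have hg : ContinuousOn (fun s => aeval ![φ s, s] P * (((α : ℝ) + β * s) / (2 * y * β)))
        (Icc ζ 1) := (hPc.comp_continuousOn hvec).mul (by fun_prop)
    refine (IntegrableOn.continuousOn_mul_of_subset hg hh isCompact_Icc measurableSet_Ioc
      Ioc_subset_Icc_self).congr_fun (fun s hs => ?_) measurableSet_Ioc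
    have hw0 : (0 : ℝ) < (α : ℝ) + β * s := by linarith [hw' s hs.1]
    have hsq : Real.sqrt (1 - 4 * y / ((α : ℝ) + β * s)) ≠ 0 := (Real.sqrt_pos.2 (hv' s hs.1)).ne'
    simp only []
    field_simp
    norm_num
  -- fundamental theorem of calculus
  have key := intervalIntegral.integral_eq_sub_of_hasDerivAt_of_le hζ1.le hGc hGd hint
  have hΦ' : ∫ s in Ioo ζ 1, aeval ![φ s, s] P /
      (((α : ℝ) + β * s) * Real.sqrt (1 - 4 * y / ((α : ℝ) + β * s))) = 0 := hΦ
  rw [intervalIntegral.integral_const_mul, intervalIntegral.integral_of_le hζ1.le,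
    integral_Ioc_eq_integral_Ioo, hΦ', mul_zero] at key
  have hφζ : φ ζ = 2⁻¹ := by
    simp only [hφ]
    rw [hwζ, div_self (by linarith), sub_self, Real.sqrt_zero]
    norm_num
  have hφ1 : φ 1 = (1 - Real.sqrt (1 - 4 * y / ((α : ℝ) + β))) / 2 := by
    simp only [hφ, mul_one]
  rw [Function.comp_apply, Function.comp_apply, hφζ, hφ1] at key
  linarith

/-- Substituting rational functions of `σ` with denominators `σ^i (1+σ)^j` into a polynomial gives
such a rational function: if `(σ(1+σ))^{nᵢ} hᵢ(σ)` are real polynomials (`σ > 0`), so is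
`(σ(1+σ))^n R(h₀(σ), h₁(σ))` for some `n`. [folklore] -/
theorem ratClosure (h₀ h₁ : ℝ → ℝ) (n₀ n₁ : ℕ) (p₀ p₁ : Polynomial ℝ)
    (H₀ : ∀ σ : ℝ, 0 < σ → (σ * (1 + σ)) ^ n₀ * h₀ σ = p₀.eval σ)
    (H₁ : ∀ σ : ℝ, 0 < σ → (σ * (1 + σ)) ^ n₁ * h₁ σ = p₁.eval σ) (R : MvPolynomial (Fin 2) ℚ) :
    ∃ (n : ℕ) (p : Polynomial ℝ), ∀ σ : ℝ, 0 < σ →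
      (σ * (1 + σ)) ^ n * aeval ![h₀ σ, h₁ σ] R = p.eval σ := by
  induction R using MvPolynomial.induction_on with
  | C c => exact ⟨0, Polynomial.C (c : ℝ), fun σ _ => by simp⟩
  | add p q hp hq =>
    obtain ⟨n, f, hf⟩ := hp
    obtain ⟨n', g, hg⟩ := hq
    refine ⟨n + n', f * (Polynomial.X * (1 + Polynomial.X)) ^ n' +
      g * (Polynomial.X * (1 + Polynomial.X)) ^ n, fun σ hσ => ?_⟩
    simp only [map_add, Polynomial.eval_add, Polynomial.eval_mul, Polynomial.eval_pow,
      Polynomial.eval_X, Polynomial.eval_one, ← hf σ hσ, ← hg σ hσ]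
    ring
  | mul_X p i hp =>
    obtain ⟨n, f, hf⟩ := hp
    fin_cases i
    · refine ⟨n + n₀, f * p₀, fun σ hσ => ?_⟩
      simp only [map_mul, MvPolynomial.aeval_X, Polynomial.eval_mul, ← hf σ hσ, ← H₀ σ hσ]
      simp
      ring
    · refine ⟨n + n₁, f * p₁, fun σ hσ => ?_⟩
      simp only [map_mul, MvPolynomial.aeval_X, Polynomial.eval_mul, ← hf σ hσ, ← H₁ σ hσ]
      simp
      ring

/-- **Log elimination on the conic.** If the `x`-primitive `F_y(x) = R(y,x)/u(x)^K + Λ(y) L(x)`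
(`u = x(1−x)`, `L = log x − log(1−x)`) takes the same value at the fold point
`x₁(y) = (1 − √(1 − 4y/(α+β)))/2` and at `x = ½` for all `y ∈ (α/4, (α+β)/4)`, then `Λ = 0`:
parametrising `x₁ = σ/(1+σ)`, `y = (α+β)σ/(1+σ)²` (`σ ∈ (α/(α+β), 1)`), `L(x₁) = log σ` and the
identity reads `g(σ) log σ = f(σ)` for real polynomials `f, g` (`ratClosure`), so `g = 0`
(`LinResidues.eq_zero_of_mul_log_eq`), i.e. `Λ` vanishes on an infinite set. [folklore] -/
theorem logElim (α β : ℝ) (hα : 0 < α) (hβ : 0 < β) (Λ : Polynomial ℚ)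
    (R : MvPolynomial (Fin 2) ℚ) (K : ℕ)
    (h : ∀ y ∈ Ioo (α / 4) ((α + β) / 4),
      aeval ![y, (1 - Real.sqrt (1 - 4 * y / (α + β))) / 2] R /
          ((1 - Real.sqrt (1 - 4 * y / (α + β))) / 2 *
            (1 - (1 - Real.sqrt (1 - 4 * y / (α + β))) / 2)) ^ K +
        (Polynomial.aeval y Λ : ℝ) * (Real.log ((1 - Real.sqrt (1 - 4 * y / (α + β))) / 2) -
          Real.log (1 - (1 - Real.sqrt (1 - 4 * y / (α + β))) / 2)) =
      aeval ![y, 2⁻¹] R / (2⁻¹ * (1 - 2⁻¹)) ^ K +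
        (Polynomial.aeval y Λ : ℝ) * (Real.log 2⁻¹ - Real.log (1 - 2⁻¹))) :
    Λ = 0 := by
  have hab : 0 < α + β := by linarith
  have hσ₀ : 0 < α / (α + β) := div_pos hα hab
  have hσ₁ : α / (α + β) < 1 := (div_lt_one hab).2 (by linarith)
  -- the identity at `y = (α+β)σ/(1+σ)²`, `x₁(y) = σ/(1+σ)`, `σ ∈ (α/(α+β), 1)`
  have hid : ∀ σ ∈ Ioo (α / (α + β)) 1,
      (Polynomial.aeval ((α + β) * σ / (1 + σ) ^ 2) Λ : ℝ) * Real.log σ =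
        aeval ![(α + β) * σ / (1 + σ) ^ 2, (2⁻¹ : ℝ)] R * 4 ^ K -
        aeval ![(α + β) * σ / (1 + σ) ^ 2, σ / (1 + σ)] R * ((1 + σ) ^ 2 / σ) ^ K := by
    intro σ hσ
    have hσ0 : 0 < σ := hσ₀.trans hσ.1
    have h1σ : 0 < 1 + σ := by linarith
    have hy1 : (α + β) * σ / (1 + σ) ^ 2 ∈ Ioo (α / 4) ((α + β) / 4) := by
      have h1 : α < σ * (α + β) := (div_lt_iff₀ hab).1 hσ.1
      have h2 : α * (1 + σ) ^ 2 < α * 4 := mul_lt_mul_of_pos_left (by nlinarith [hσ.2]) hα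
      have h3 := mul_pos hab (pow_pos (sub_pos.2 hσ.2) 2)
      constructor
      · rw [div_lt_div_iff₀ (by norm_num) (by positivity)]
        nlinarith
      · rw [div_lt_div_iff₀ (by positivity) (by norm_num)]
        nlinarith
    have hsq : Real.sqrt (1 - 4 * ((α + β) * σ / (1 + σ) ^ 2) / (α + β)) = (1 - σ) / (1 + σ) := by
      rw [show 1 - 4 * ((α + β) * σ / (1 + σ) ^ 2) / (α + β) = ((1 - σ) / (1 + σ)) ^ 2 by
        field_simp; ring]
      exact Real.sqrt_sq (div_nonneg (by linarith [hσ.2]) h1σ.le)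
    have h2 := h _ hy1
    have ht : (1 - Real.sqrt (1 - 4 * ((α + β) * σ / (1 + σ) ^ 2) / (α + β))) / 2 =
        σ / (1 + σ) := by
      rw [hsq]
      field_simp
      ring
    have hlog : Real.log (σ / (1 + σ)) - Real.log (1 - σ / (1 + σ)) = Real.log σ := by
      rw [show 1 - σ / (1 + σ) = 1 / (1 + σ) by field_simp; ring, Real.log_div hσ0.ne' h1σ.ne',
        Real.log_div one_ne_zero h1σ.ne', Real.log_one]
      ring
    have hu : σ / (1 + σ) * (1 - σ / (1 + σ)) = (((1 + σ) ^ 2 / σ))⁻¹ := by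
      rw [inv_div]; field_simp; ring
    rw [ht, hlog, hu, show (1 : ℝ) - 2⁻¹ = 2⁻¹ by norm_num, sub_self, mul_zero, add_zero,
      show ((2 : ℝ)⁻¹ * 2⁻¹) = 4⁻¹ by norm_num, inv_pow, inv_pow, div_inv_eq_mul,
      div_inv_eq_mul] at h2
    linarith
  -- every term is `(polynomial in σ)/(σ(1+σ))^n`
  have HY : ∀ σ : ℝ, 0 < σ → (σ * (1 + σ)) ^ 2 * ((α + β) * σ / (1 + σ) ^ 2) =
      (Polynomial.C (α + β) * Polynomial.X ^ 3).eval σ := fun σ hσ => by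
    simp only [Polynomial.eval_mul, Polynomial.eval_C, Polynomial.eval_pow, Polynomial.eval_X]
    field_simp
  have HT : ∀ σ : ℝ, 0 < σ → (σ * (1 + σ)) ^ 1 * (σ / (1 + σ)) =
      (Polynomial.X ^ 2 : Polynomial ℝ).eval σ := fun σ hσ => by
    simp only [Polynomial.eval_pow, Polynomial.eval_X]
    field_simp
  have Hc : ∀ σ : ℝ, 0 < σ → (σ * (1 + σ)) ^ 0 * (2⁻¹ : ℝ) = (Polynomial.C (2⁻¹ : ℝ)).eval σ :=
    fun σ _ => by simp
  obtain ⟨n₁, f₁, hf₁⟩ := ratClosure _ _ 2 1 _ _ HY HT R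
  obtain ⟨n₂, f₂, hf₂⟩ := ratClosure _ _ 2 0 _ _ HY Hc R
  obtain ⟨n₃, g₃, hg₃⟩ :=
    ratClosure _ _ 2 1 _ _ HY HT (Polynomial.aeval (X 0 : MvPolynomial (Fin 2) ℚ) Λ)
  have hg₃' : ∀ σ : ℝ, 0 < σ → (σ * (1 + σ)) ^ n₃ *
      (Polynomial.aeval ((α + β) * σ / (1 + σ) ^ 2) Λ : ℝ) = g₃.eval σ := by
    intro σ hσ
    rw [← hg₃ σ hσ, ← Polynomial.aeval_algHom_apply, MvPolynomial.aeval_X, Matrix.cons_val_zero]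
  -- `g log σ = f` on the interval, hence `g = 0`
  set g : Polynomial ℝ := g₃ * (Polynomial.X * (1 + Polynomial.X)) ^ (n₁ + n₂ + K) with hg
  set f : Polynomial ℝ := Polynomial.C ((4 : ℝ) ^ K) * f₂ *
      (Polynomial.X * (1 + Polynomial.X)) ^ (n₃ + n₁ + K) -
    f₁ * (Polynomial.X * (1 + Polynomial.X)) ^ (n₃ + n₂) * (1 + Polynomial.X) ^ (3 * K) with hf
  have hfg : ∀ σ ∈ Ioo (α / (α + β)) 1, g.eval σ * Real.log σ = f.eval σ := by
    intro σ hσ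
    have hσ0 : 0 < σ := hσ₀.trans hσ.1
    have h1 := hid σ hσ
    have h3 : ((1 + σ) ^ 2 / σ) ^ K * (σ * (1 + σ)) ^ K = (1 + σ) ^ (3 * K) := by
      rw [← mul_pow, pow_mul]
      congr 1
      field_simp
    simp only [hg, hf, Polynomial.eval_mul, Polynomial.eval_pow, Polynomial.eval_add,
      Polynomial.eval_sub, Polynomial.eval_X, Polynomial.eval_C, Polynomial.eval_one,
      ← hg₃' σ hσ0, ← hf₁ σ hσ0, ← hf₂ σ hσ0]
    linear_combination (σ * (1 + σ)) ^ (n₃ + n₁ + n₂ + K) * h1 -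
      aeval ![(α + β) * σ / (1 + σ) ^ 2, σ / (1 + σ)] R * (σ * (1 + σ)) ^ (n₁ + n₂ + n₃) * h3
  have hg0 : g = 0 := LinResidues.eq_zero_of_mul_log_eq hσ₀ hσ₁ _ f g le_rfl hfg
  have hroot : ∀ σ ∈ Ioo (α / (α + β)) 1,
      (Polynomial.aeval ((α + β) * σ / (1 + σ) ^ 2) Λ : ℝ) = 0 := by
    intro σ hσ
    have hσ0 : 0 < σ := hσ₀.trans hσ.1
    have hM : σ * (1 + σ) ≠ 0 := by positivity
    have h1 : g.eval σ = 0 := by rw [hg0, Polynomial.eval_zero]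
    simp only [hg, Polynomial.eval_mul, Polynomial.eval_pow, Polynomial.eval_X,
      Polynomial.eval_add, Polynomial.eval_one, ← hg₃' σ hσ0, mul_eq_zero,
      pow_eq_zero_iff', hM, false_and, or_false, false_or] at h1
    exact h1
  -- `Λ` has infinitely many roots
  have hinj : InjOn (fun σ : ℝ => (α + β) * σ / (1 + σ) ^ 2) (Ioo (α / (α + β)) 1) := by
    intro σ hσ σ' hσ' heq
    have hσ0 : 0 < σ := hσ₀.trans hσ.1
    have hσ0' : 0 < σ' := hσ₀.trans hσ'.1
    simp only [] at heq
    rw [div_eq_div_iff (by positivity) (by positivity)] at heq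
    have heq' : σ * (1 + σ') ^ 2 = σ' * (1 + σ) ^ 2 :=
      mul_left_cancel₀ hab.ne' (by linear_combination heq)
    have h3 : (σ - σ') * (1 - σ * σ') = 0 := by linear_combination heq'
    rcases mul_eq_zero.1 h3 with h3 | h3
    · linarith
    · have := mul_lt_mul'' hσ.2 hσ'.2 hσ0.le hσ0'.le
      linarith
  have hΛ : Λ.map (algebraMap ℚ ℝ) = 0 := by
    apply Polynomial.eq_zero_of_infinite_isRoot
    refine ((Ioo_infinite hσ₁).image hinj).mono ?_
    rintro _ ⟨σ, hσ, rfl⟩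
    simp only [Set.mem_setOf_eq, Polynomial.IsRoot.def, Polynomial.eval_map_algebraMap]
    exact hroot σ hσ
  exact Polynomial.map_injective _ (algebraMap ℚ ℝ).injective (by rw [hΛ, Polynomial.map_zero])

end SfLogCoeff

open SfLogCoeff in
/-- STUB `stub_sfLogCoeff` (symmetric-fold class, step 3a: the `log`-coefficient of a primitive of
the residue form vanishes). For `P ∈ ℚ[x,s]`, `0 < α`, `0 < β`, `u = x(1−x)`: if the fold density
`∫_{(4y−α)/β}^1 P(φ(s),s)/(w√(1−4y/w)) ds` vanishes for `y ∈ (α/4, (α+β)/4)`, and for every real `y`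
`x ↦ R(y,x)/u^K + Λ(y)(log|x| − log|1−x|)` (`R ∈ ℚ[y,x]`, `Λ ∈ ℚ[y]`) is a primitive of
`x ↦ P(x, (y/u − α)/β)/u` off `{0,1}`, then `Λ = 0`: FTC in the fold coordinate (`ftc`) gives
`F_y(x₁(y)) = F_y(½)`, and log-elimination on the rationally parametrised conic (`logElim`).
[cite: KontsevichZagier2001, §1.2] -/
theorem stub_sfLogCoeff (α β : ℚ) (P : MvPolynomial (Fin 2) ℚ) (hα : 0 < α) (hβ : 0 < β)
    (hΦ : ∀ y ∈ Ioo ((α : ℝ) / 4) (((α : ℝ) + β) / 4), ∫ s in Ioo ((4 * y - α) / β) 1,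
      aeval ![(1 - Real.sqrt (1 - 4 * y / ((α : ℝ) + β * s))) / 2, s] P /
        (((α : ℝ) + β * s) * Real.sqrt (1 - 4 * y / ((α : ℝ) + β * s))) = 0)
    (K : ℕ) (R : MvPolynomial (Fin 2) ℚ) (Λ : Polynomial ℚ)
    (hF : ∀ y x : ℝ, x ≠ 0 → x ≠ 1 →
      HasDerivAt (fun x' : ℝ => aeval ![y, x'] R / (x' * (1 - x')) ^ K +
          (Polynomial.aeval y Λ : ℝ) * (Real.log x' - Real.log (1 - x')))
        (aeval ![x, (y / (x * (1 - x)) - α) / β] P / (x * (1 - x))) x) :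
    Λ = 0 :=
  logElim (α : ℝ) β (by exact_mod_cast hα) (by exact_mod_cast hβ) Λ R K fun y hy =>
    ftc α β P hα hβ y hy (hΦ y hy) _ (hF y)

end Summit.KontsevichZagierPeriods.InverseLandau.TateFamilyKernel.Descent
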